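import Literature.AlgebraicGeometry.Surfaces.KummerLattice
import HarnessLib

/-!
# The Nikulin lattice `N = ⟨N₁, …, N₈, (N₁ + ⋯ + N₈)/2⟩ ⊃ ⟨-2⟩^{⊕8}`

[cite: VanGeemenSarti2007, §1.5 ("The Nikulin lattice")] [cite: VanGeemenSarti2007, §1.10 (proof of Lemma 1.10: `N^*` and `A_N ≅ (ℤ/2ℤ)⁶`)]
[cite: Morrison1984, §5 (Def. 5.3)]

Van Geemen–Sarti, *Nikulin involutions on K3 surfaces*, §1.5: "The minimal primitive sublattice of
`H²(Y,ℤ)` containing the `Nᵢ` is called the Nikulin lattice `N` (cf. [Morrison]). As `Nᵢ² = -2`, `NᵢNⱼ = 0`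
for `i ≠ j`, the Nikulin lattice contains the lattice `⟨-2⟩⁸`. The lattice `N` has rank eight and is
spanned by the `Nᵢ` and a class `N̂`: `N = ⟨N₁, …, N₈, N̂⟩`, `N̂ := (N₁ + ⋯ + N₈)/2`."
§1.10 (proof of Lemma 1.10): "The Nikulin lattice `N` contains `⊕ ℤNᵢ` with `Nᵢ² = -2`, hence
`N^* ⊂ ℤ(Nᵢ/2)`. As `N = ⟨Nᵢ, (ΣNᵢ)/2⟩` we find that `n^* ∈ ℤ(Nᵢ/2)` is in `N^*` iff `n^*·(ΣNᵢ)/2 ∈ ℤ`,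
that is, `n^* = Σ xᵢ(Nᵢ/2)` with `Σ xᵢ ≡ 0 mod 2`. Thus we obtain an identification
`A_N = N^*/N = {(x₁,…,x₈) ∈ (ℤ/2ℤ)⁸ : Σ xᵢ = 0}/⟨(1,…,1)⟩ ≅ (ℤ/2ℤ)⁶`, where `(1,…,1)` is the image of
`(ΣNᵢ)/2`."

## What is here (the algebraic description, in the `Λ^*`-model — the sibling of `KummerLattice.lean`)

`Λ = ⊕_{i<8} ℤ·Nᵢ = (Fin 8 → ℤ)` carries `nikulinNodeForm = ⟨-2⟩^{⊕8}`, the twist by `2` of the unimodular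
`nikulinBaseForm = ⟨-1⟩^{⊕8}`; `y ↦ nikulinBaseForm y = -(y . _)` identifies `⊕ ℤ·(Nᵢ/2)` with `Λ^*` and
`i_Λ = nikulinNodeForm`. The geometric definition ("minimal primitive sublattice of `H²(Y,ℤ)` containing the
`Nᵢ`") is not formalised; `N` is vendored through its printed generators.

* §1 `nikulinBaseForm`, `nikulinNodeForm = ⟨-2⟩^{⊕8}` (even, negative definite, `|A| = 2⁸`, `2·A = 0`,
  `Λ^* = ⊕ ℤ·(Nᵢ/2)`: `two_smul_mem_range_nikulinNodeForm`).
* §2 `N̂ = (N₁ + ⋯ + N₈)/2 ∈ Λ^*` (`nikulinHat`, `two_smul_nikulinHat`), **the Nikulin lattice**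
  `nikulinLattice = i_Λ(Λ) + ℤ·N̂ ⊂ Λ^*`, the residue map `r : A_Λ ⥲ (ℤ/2ℤ)⁸` (`nikulinResidue`,
  `nikulinResidue_mk`, "`(1,…,1)` is the image of `(ΣNᵢ)/2`": `nikulinResidue_mk_nikulinHat`),
  `N/Λ = ℤ·[N̂]` of order `2` (`natCard_map_mkQ_nikulinLattice`), **`[N : ⊕ ℤNᵢ] = 2`** (`index_nikulinLattice`).
* §3 `N/Λ` is `q_Λ`-isotropic (`N̂² = -4`), so `N` is an integral even lattice: `nikulinForm`,
  `isEven_nikulinForm`, `negDef_nikulinForm`, `finrank_nikulinLattice = 8` ("The lattice `N` has rank eight"),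
  `nikulinForm_toOverlattice` (`⟨-2⟩⁸ ⊂ N` is a sublattice), `nikulinForm_hat_hat : N̂² = -4`.
* §4 **`N^*`**: "`n^* = Σ xᵢ(Nᵢ/2)` is in `N^*` iff `Σ xᵢ ≡ 0 mod 2`" (`mem_dual_nikulinLattice_iff`).
* §5 **`A_N ≅ (ℤ/2ℤ)⁶`**: `|A_N| = 2⁶` (from (0.1): `|A_N| · [N : Λ]² = |A_Λ| = 2⁸`), `2 · A_N = 0`,
  `nonempty_discriminantGroup_nikulinForm_addEquiv`, `A_N ≃ A_{U(2)^{⊕3}}` as groups and `ℓ(N) = 6`.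
* §6 **the values of `q_N`**: `q_N(Σ yᵢ(Nᵢ/2)) = −(Σ yᵢ²)/2 mod 2ℤ` (`discriminantQuad_nikulinForm_mk`, via
  `q_N([θ]) = q_Λ([θ|_Λ])`), so "`((Nᵢ + Nⱼ)/2)² = 1 mod 2ℤ`", "`((N₁ + Nᵢ + Nⱼ + N_k)/2)² = 0 mod 2`" and `q_N` is
  `ℤ/2ℤ`-valued (`discriminantQuad_nikulinForm_pair`, `_quadruple`, `_mk_of_zero_one`).

NOT here: the geometric definition and the eight fixed points (`K3NikulinInvolution.lean`), the isometry class
`q_N ≅ -q_{U(2)^{⊕3}}` and the unique representatives `0`, `(Nᵢ + Nⱼ)/2`, `(N₁ + Nᵢ + Nⱼ + N_k)/2` of `A_N`;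
Lemma 1.10 itself (the gluing `U(2)^{⊕3} ⊕ N ⊂ U^{⊕3} ⊕ E₈(-1)`) is `NikulinLatticeGluing.lean`.
-/

noncomputable section

open Module Function Matrix
open LinearMap (BilinForm)
open LinearMap.BilinForm

namespace Literature.AlgebraicGeometry.Surfaces

/-! ### §1 The eight nodes: `Λ = ⊕ ℤ·Nᵢ ≅ ⟨-2⟩^{⊕8} = ⟨-1⟩^{⊕8}(2)` -/

/-- The auxiliary unimodular lattice `⟨-1⟩^{⊕8}` on `⊕ ℤ·Nᵢ = (Fin 8 → ℤ)`, `(x . y) = -Σ xᵢ yᵢ`; the node lattice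
`⟨-2⟩^{⊕8}` is its twist by `2`, and `y ↦ nikulinBaseForm y` identifies `⊕ ℤ·(Nᵢ/2)` with `Λ^*`.
[cite: VanGeemenSarti2007, §1.5 ("contains the lattice `⟨-2⟩⁸`")] [cite: VanGeemenSarti2007, §1.10 ("`N^* ⊂ ℤ(Nᵢ/2)`")] -/
def nikulinBaseForm : BilinForm ℤ (Fin 8 → ℤ) :=
  Matrix.toBilin' (-1 : Matrix (Fin 8) (Fin 8) ℤ)

/-- `⟨-1⟩^{⊕8}`: `(x . y) = -Σᵢ xᵢ yᵢ`. [cite: VanGeemenSarti2007, §1.5] -/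
theorem nikulinBaseForm_apply (x y : Fin 8 → ℤ) : nikulinBaseForm x y = -(x ⬝ᵥ y) := by
  rw [nikulinBaseForm, Matrix.toBilin'_apply', Matrix.neg_mulVec, Matrix.one_mulVec, dotProduct_neg]

/-- `⟨-1⟩^{⊕8}` is symmetric. [cite: VanGeemenSarti2007, §1.5] -/
theorem isSymm_nikulinBaseForm : nikulinBaseForm.IsSymm :=
  ⟨fun x y ↦ by rw [nikulinBaseForm_apply, nikulinBaseForm_apply, dotProduct_comm]⟩

/-- `⟨-1⟩^{⊕8}` is unimodular (`det(-1) = 1`). [cite: Huybrechts2016K3, Ch. 14 §0.3 (i)] -/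
theorem isUnimodular_nikulinBaseForm : nikulinBaseForm.IsUnimodular := by
  rw [nikulinBaseForm, isUnimodular_iff_isUnit_det_holds _ (Pi.basisFun ℤ (Fin 8)),
    LinearMap.BilinForm.toMatrix_basisFun, LinearMap.BilinForm.toMatrix'_toBilin', Matrix.det_neg,
    Matrix.det_one, mul_one]
  exact isUnit_one.neg.pow _

/-- `⟨-1⟩^{⊕8}` is nondegenerate. [cite: Huybrechts2016K3, Ch. 14 §0.1] -/
theorem nondegenerate_nikulinBaseForm : nikulinBaseForm.Nondegenerate :=
  isUnimodular_nikulinBaseForm.nondegenerate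

/-- **The node lattice `⊕_{i<8} ℤ·Nᵢ ≅ ⟨-2⟩⁸`** of the eight nodal classes (`Nᵢ² = -2`, `NᵢNⱼ = 0`), as the
twist `⟨-1⟩^{⊕8}(2)`; as a map `Λ → Λ^*` it is `i_Λ`. [cite: VanGeemenSarti2007, §1.5 ("As `Nᵢ² = -2`, `NᵢNⱼ = 0` for `i ≠ j`, the Nikulin lattice contains the lattice `⟨-2⟩⁸`")] -/
abbrev nikulinNodeForm : BilinForm ℤ (Fin 8 → ℤ) := (2 : ℤ) • nikulinBaseForm

/-- `(x . y)_{⊕ℤN} = -2 Σᵢ xᵢ yᵢ`. [cite: VanGeemenSarti2007, §1.5] -/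
theorem nikulinNodeForm_apply (x y : Fin 8 → ℤ) : nikulinNodeForm x y = -2 * (x ⬝ᵥ y) := by
  rw [smul_apply_apply, nikulinBaseForm_apply, mul_neg, neg_mul]

/-- **`Nᵢ² = -2` and `NᵢNⱼ = 0` for `i ≠ j`.** [cite: VanGeemenSarti2007, §1.5] -/
theorem nikulinNodeForm_single_single (i j : Fin 8) :
    nikulinNodeForm (Pi.single i 1) (Pi.single j 1) = if i = j then -2 else 0 := by
  rw [nikulinNodeForm_apply, single_dotProduct, one_mul, Pi.single_apply]
  split_ifs <;> simp

/-- `⟨-2⟩⁸` is symmetric. [cite: VanGeemenSarti2007, §1.5] -/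
theorem isSymm_nikulinNodeForm : nikulinNodeForm.IsSymm :=
  nikulinBaseForm.isSymm_smul_of_isSymm 2 isSymm_nikulinBaseForm

/-- `⟨-2⟩⁸` is nondegenerate. [cite: VanGeemenSarti2007, §1.5] -/
theorem nondegenerate_nikulinNodeForm : nikulinNodeForm.Nondegenerate :=
  (nikulinBaseForm.nondegenerate_zsmul_iff two_ne_zero).2 nondegenerate_nikulinBaseForm

/-- `⟨-2⟩⁸` is even. [cite: VanGeemenSarti2007, §1.5 ("`Nᵢ² = -2`")] -/
theorem isEven_nikulinNodeForm : nikulinNodeForm.IsEven := fun x ↦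
  ⟨-(x ⬝ᵥ x), by rw [nikulinNodeForm_apply]; ring⟩

/-- `⟨-2⟩⁸` is negative definite. [cite: VanGeemenSarti2007, §1.5] -/
theorem negDef_nikulinNodeForm : nikulinNodeForm.NegDef := by
  rw [negDef_iff]
  intro x hx
  have h0 : 0 ≤ x ⬝ᵥ x := Finset.sum_nonneg fun v _ ↦ mul_self_nonneg (x v)
  have h1 : x ⬝ᵥ x ≠ 0 := fun h ↦ hx (dotProduct_self_eq_zero.1 h)
  rw [nikulinNodeForm_apply]
  omega

/-- **`|A_{⊕ℤN}| = 2⁸`** (`disc ⟨-2⟩⁸ = 2⁸`). [cite: VanGeemenSarti2007, §1.10] [cite: Huybrechts2016K3, Ch. 14 §0.3 (iv)] -/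
theorem natCard_discriminantGroup_nikulinNodeForm : Nat.card nikulinNodeForm.discriminantGroup = 2 ^ 8 := by
  rw [nikulinBaseForm.natCard_discriminantGroup_smul_of_isUnimodular 2 isUnimodular_nikulinBaseForm
    (Pi.basisFun ℤ (Fin 8)), Fintype.card_fin]
  rfl

/-- `2 · A_{⊕ℤN} = 0`. [cite: VanGeemenSarti2007, §1.10 ("`N^* ⊂ ℤ(Nᵢ/2)`")] -/
theorem two_smul_discriminantGroup_nikulinNodeForm (a : nikulinNodeForm.discriminantGroup) : (2 : ℤ) • a = 0 :=
  nikulinBaseForm.smul_eq_zero_of_isUnimodular 2 isUnimodular_nikulinBaseForm a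

/-- **`Λ^* = ⊕ ℤ·(Nᵢ/2)`, i.e. `2 Λ^* = i_Λ(Λ)`.** [cite: VanGeemenSarti2007, §1.10 ("`N^* ⊂ ℤ(Nᵢ/2)`")] -/
theorem two_smul_mem_range_nikulinNodeForm (f : Module.Dual ℤ (Fin 8 → ℤ)) :
    (2 : ℤ) • f ∈ LinearMap.range nikulinNodeForm := by
  haveI : nikulinBaseForm.IsPerfPair := isUnimodular_nikulinBaseForm
  obtain ⟨x, rfl⟩ := (LinearMap.IsPerfPair.bijective_left nikulinBaseForm).2 f
  exact ⟨x, rfl⟩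

/-! ### §2 `N̂ = (N₁ + ⋯ + N₈)/2`, the Nikulin lattice `N = ⟨N₁, …, N₈, N̂⟩`, the index `[N : ⊕ℤNᵢ] = 2` -/

/-- **`N̂ := (N₁ + ⋯ + N₈)/2`** as the functional `(N̂ . _) = -Σᵢ (_)ᵢ` on `⊕ ℤ·Nᵢ`, i.e. the element
`nikulinBaseForm (1, …, 1)` of `Λ^*` (`two_smul_nikulinHat`). [cite: VanGeemenSarti2007, §1.5 ("`N̂ := (N₁ + … + N₈)/2`")] [cite: Morrison1984, §5 (Def. 5.3)] -/
def nikulinHat : Module.Dual ℤ (Fin 8 → ℤ) :=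
  nikulinBaseForm 1

/-- `(N̂ . x) = -Σᵢ xᵢ`. [cite: VanGeemenSarti2007, §1.5] -/
theorem nikulinHat_apply (x : Fin 8 → ℤ) : nikulinHat x = -∑ i, x i := by
  rw [nikulinHat, nikulinBaseForm_apply, one_dotProduct]

/-- **`2 · N̂ = N₁ + ⋯ + N₈ ∈ ⊕ ℤ·Nᵢ`**: in `Λ^*`, `2 · N̂ = i_Λ(1, …, 1)`. [cite: VanGeemenSarti2007, §1.5] -/
theorem two_smul_nikulinHat : (2 : ℤ) • nikulinHat = nikulinNodeForm 1 :=
  rfl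

/-- **The Nikulin lattice `N = ⟨N₁, …, N₈, N̂⟩`**, realised in `Λ^* = Hom(⊕ ℤ·Nᵢ, ℤ) ⊂ Λ_ℚ` as
`i_Λ(Λ) + ℤ·N̂`; its form is `nikulinForm` (§3). [cite: VanGeemenSarti2007, §1.5 ("`N = ⟨N₁, …, N₈, N̂⟩`")] [cite: Morrison1984, §5 (Def. 5.3)] -/
def nikulinLattice : Submodule ℤ (Module.Dual ℤ (Fin 8 → ℤ)) :=
  LinearMap.range nikulinNodeForm ⊔ Submodule.span ℤ {nikulinHat}

/-- **`⊕ ℤ·Nᵢ ⊂ N`.** [cite: VanGeemenSarti2007, §1.5 ("the Nikulin lattice contains the lattice `⟨-2⟩⁸`")] -/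
theorem range_nikulinNodeForm_le : LinearMap.range nikulinNodeForm ≤ nikulinLattice :=
  le_sup_left

/-- `i_Λ(x) ∈ N` for `x ∈ ⊕ ℤ·Nᵢ`. [cite: VanGeemenSarti2007, §1.5] -/
theorem nikulinNodeForm_mem_nikulinLattice (x : Fin 8 → ℤ) : nikulinNodeForm x ∈ nikulinLattice :=
  range_nikulinNodeForm_le (LinearMap.mem_range_self _ x)

/-- **`N̂ ∈ N`.** [cite: VanGeemenSarti2007, §1.5] -/
theorem nikulinHat_mem_nikulinLattice : nikulinHat ∈ nikulinLattice :=
  Submodule.mem_sup_right (Submodule.mem_span_singleton_self _)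

/-- **The residue map `r : Λ^*/Λ = ⊕ ℤ(Nᵢ/2)/⊕ ℤNᵢ ⥲ (ℤ/2ℤ)⁸`**, "`n^* = Σ xᵢ(Nᵢ/2)` ↦ `(xᵢ mod 2)ᵢ`" (the
isomorphism `A_{⟨-1⟩⁸(2)} ⥲ (Fin 8 → ℤ/2ℤ)` of `LatticeFormsTwistDiscriminantGroup.lean`).
[cite: VanGeemenSarti2007, §1.10 ("`{(x₁,…,x₈) ∈ (ℤ/2ℤ)⁸ : …}`")] [cite: Huybrechts2016K3, Ch. 14 §0.3 (iv)] -/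
def nikulinResidue : nikulinNodeForm.discriminantGroup ≃ₗ[ℤ] (Fin 8 → ZMod 2) :=
  nikulinBaseForm.discriminantGroupSmulEquivPiZMod 2 isUnimodular_nikulinBaseForm (Pi.basisFun ℤ (Fin 8))

/-- `r[Σ yᵢ(Nᵢ/2)] = (yᵢ mod 2)ᵢ`, i.e. `r [nikulinBaseForm y] = y mod 2`. [cite: VanGeemenSarti2007, §1.10] -/
theorem nikulinResidue_mk (y : Fin 8 → ℤ) :
    nikulinResidue (Submodule.Quotient.mk (nikulinBaseForm y)) = fun i ↦ ((y i : ℤ) : ZMod 2) := by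
  have h := nikulinBaseForm.discriminantGroupSmulEquivPiZMod_mk_apply 2 isUnimodular_nikulinBaseForm
    (Pi.basisFun ℤ (Fin 8)) y
  simp only [Pi.basisFun_repr] at h
  exact h

/-- **"`(1,…,1)` is the image of `(ΣNᵢ)/2`"**: `r[N̂] = (1, …, 1)`. [cite: VanGeemenSarti2007, §1.10] -/
theorem nikulinResidue_mk_nikulinHat : nikulinResidue (Submodule.Quotient.mk nikulinHat) = 1 := by
  rw [nikulinHat, nikulinResidue_mk]
  funext i
  rw [Pi.one_apply, Pi.one_apply, Int.cast_one]

/-- `[N̂] ≠ 0` in `A_Λ`: `N̂ ∉ ⊕ ℤ·Nᵢ`. [cite: VanGeemenSarti2007, §1.5] -/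
theorem mk_nikulinHat_ne_zero : (Submodule.Quotient.mk nikulinHat : nikulinNodeForm.discriminantGroup) ≠ 0 := by
  intro h
  have h1 := nikulinResidue_mk_nikulinHat
  rw [h, map_zero] at h1
  exact zero_ne_one (congrFun h1 0)

/-- `2 · [N̂] = 0` in `A_Λ`. [cite: VanGeemenSarti2007, §1.5 ("`N̂ := (N₁ + … + N₈)/2`")] -/
theorem two_smul_mk_nikulinHat : (2 : ℤ) • (Submodule.Quotient.mk nikulinHat : nikulinNodeForm.discriminantGroup) = 0 :=
  two_smul_discriminantGroup_nikulinNodeForm _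

/-- `[N̂]` has order `2` in `A_Λ`. [cite: VanGeemenSarti2007, §1.5] -/
theorem addOrderOf_mk_nikulinHat :
    addOrderOf (Submodule.Quotient.mk nikulinHat : nikulinNodeForm.discriminantGroup) = 2 := by
  refine addOrderOf_eq_prime ?_ mk_nikulinHat_ne_zero
  rw [← natCast_zsmul]
  exact two_smul_mk_nikulinHat

/-- `N/Λ = π(N) = ℤ·[N̂] ⊂ A_Λ` (`π ∘ i_Λ = 0`). [cite: VanGeemenSarti2007, §1.10 ("`⟨(1,…,1)⟩`")] [cite: Huybrechts2016K3, Ch. 14 §0.2] -/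
theorem map_mkQ_nikulinLattice :
    nikulinLattice.map nikulinNodeForm.discriminantGroupMkQ = Submodule.span ℤ {Submodule.Quotient.mk nikulinHat} := by
  have h0 : (LinearMap.range nikulinNodeForm).map nikulinNodeForm.discriminantGroupMkQ = ⊥ :=
    Submodule.mkQ_map_self _
  rw [nikulinLattice, Submodule.map_sup, h0, bot_sup_eq, Submodule.map_span, Set.image_singleton,
    discriminantGroupMkQ_apply]

/-- An element of order `2` spans a subgroup of order `2`. [cite: VanGeemenSarti2007, §1.10] -/
theorem natCard_span_singleton_of_addOrderOf {A : Type*} [AddCommGroup A] (a : A) {n : ℕ} (ha : addOrderOf a = n) :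
    Nat.card (Submodule.span ℤ ({a} : Set A)) = n := by
  rw [← ha, ← Nat.card_zmultiples a, AddSubgroup.zmultiples_eq_closure, ← Submodule.span_int_eq_addSubgroupClosure]
  rfl

/-- **`|N/Λ| = 2`.** [cite: VanGeemenSarti2007, §1.5] -/
theorem natCard_map_mkQ_nikulinLattice : Nat.card (nikulinLattice.map nikulinNodeForm.discriminantGroupMkQ) = 2 := by
  rw [map_mkQ_nikulinLattice]
  exact natCard_span_singleton_of_addOrderOf _ addOrderOf_mk_nikulinHat

/-- **`[N : ⊕ ℤ·Nᵢ] = 2`** (the sum of the eight nodes is `2`-divisible in `N` and nothing more).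
[cite: VanGeemenSarti2007, §1.5 ("spanned by the `Nᵢ` and a class `N̂`")] [cite: Morrison1984, §5] -/
theorem index_nikulinLattice :
    (LinearMap.range (nikulinNodeForm.toOverlattice nikulinLattice range_nikulinNodeForm_le)).toAddSubgroup.index = 2 := by
  rw [index_range_toOverlattice, natCard_map_mkQ_nikulinLattice]

/-- `N = L_{N/Λ}`: the Nikulin lattice is the overlattice of `⊕ ℤ·Nᵢ` attached to `ℤ·[N̂] ⊂ A_Λ`.
[cite: Huybrechts2016K3, Ch. 14 §0.2] [cite: VanGeemenSarti2007, §1.10 ("`L` is determined by the image of `L/M` in … `A_M`")] -/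
theorem overlattice_map_mkQ_nikulinLattice :
    nikulinNodeForm.overlattice (nikulinLattice.map nikulinNodeForm.discriminantGroupMkQ) = nikulinLattice :=
  nikulinNodeForm.overlattice_map_mkQ range_nikulinNodeForm_le

/-! ### §3 `N/Λ` is isotropic: `N` is an even negative definite lattice of rank `8` -/

/-- **`q_Λ[N̂] = N̂² = 8·(-2)/4 = -4 ≡ 0 (mod 2ℤ)`.** [cite: VanGeemenSarti2007, §1.10 ("the discriminant form … is identically zero on the subgroup `L/M`")] -/
theorem discriminantQuad_mk_nikulinHat :
    nikulinNodeForm.discriminantQuad nondegenerate_nikulinNodeForm isSymm_nikulinNodeForm isEven_nikulinNodeForm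
      (Submodule.Quotient.mk nikulinHat) = 0 := by
  change ((2 : ℤ) • nikulinBaseForm).discriminantQuad _ _ _ (nikulinBaseForm.twistIncl 2 (Submodule.Quotient.mk 1)) = 0
  rw [nikulinBaseForm.discriminantQuad_smul_twistIncl_mk 2 nondegenerate_nikulinBaseForm two_ne_zero,
    nikulinBaseForm_apply, AddCircle.coe_eq_zero_iff]
  refine ⟨-2, ?_⟩
  rw [one_dotProduct]
  simp only [Pi.one_apply, Finset.sum_const, Finset.card_univ, Fintype.card_fin]
  push_cast
  norm_num

/-- **`q_Λ` vanishes on `N/Λ = ℤ·[N̂]`.** [cite: VanGeemenSarti2007, §1.10] [cite: Huybrechts2016K3, Ch. 14 §0.2] -/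
theorem discriminantQuad_eq_zero_of_mem_map_mkQ_nikulinLattice (a : nikulinNodeForm.discriminantGroup)
    (ha : a ∈ nikulinLattice.map nikulinNodeForm.discriminantGroupMkQ) :
    nikulinNodeForm.discriminantQuad nondegenerate_nikulinNodeForm isSymm_nikulinNodeForm isEven_nikulinNodeForm a =
      0 := by
  rw [map_mkQ_nikulinLattice, Submodule.mem_span_singleton] at ha
  obtain ⟨k, rfl⟩ := ha
  rw [discriminantQuad_smul, discriminantQuad_mk_nikulinHat, smul_zero]

/-- **The pairing `( . )_{Λ_ℚ}` is integral on `N`.** [cite: VanGeemenSarti2007, §1.10 ("`b = b_M` extends to a `ℤ`-valued bilinear form on `L ⊂ M^*`")] -/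
theorem nikulinLattice_integral :
    ∀ f ∈ nikulinLattice, ∀ g ∈ nikulinLattice, ∃ n : ℤ, nikulinNodeForm.dualForm f g = n := by
  have h := ((nikulinNodeForm.forall_discriminantQuad_eq_zero_iff_integral_even nondegenerate_nikulinNodeForm
    isSymm_nikulinNodeForm isEven_nikulinNodeForm _).1 discriminantQuad_eq_zero_of_mem_map_mkQ_nikulinLattice).1
  rwa [overlattice_map_mkQ_nikulinLattice] at h

/-- **`(f . f)_{Λ_ℚ} ∈ 2ℤ` on `N`.** [cite: VanGeemenSarti2007, §1.10 ("If `L` is an even lattice …")] -/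
theorem nikulinLattice_even : ∀ f ∈ nikulinLattice, ∃ k : ℤ, nikulinNodeForm.dualForm f f = 2 * k := by
  have h := ((nikulinNodeForm.forall_discriminantQuad_eq_zero_iff_integral_even nondegenerate_nikulinNodeForm
    isSymm_nikulinNodeForm isEven_nikulinNodeForm _).1 discriminantQuad_eq_zero_of_mem_map_mkQ_nikulinLattice).2
  rwa [overlattice_map_mkQ_nikulinLattice] at h

/-- **The Nikulin lattice `(N, ( . ))`**: the integral bilinear form of `N ⊂ Λ_ℚ`. [cite: VanGeemenSarti2007, §1.5] [cite: Morrison1984, §5 (Def. 5.3)] -/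
def nikulinForm : BilinForm ℤ nikulinLattice :=
  nikulinNodeForm.integralForm nikulinLattice nikulinLattice_integral

/-- `((f . g)_N : ℚ) = (f . g)_{Λ_ℚ}`. [cite: VanGeemenSarti2007, §1.5] -/
theorem nikulinForm_apply (f g : nikulinLattice) :
    ((nikulinForm f g : ℤ) : ℚ) = nikulinNodeForm.dualForm f g :=
  nikulinNodeForm.integralForm_apply _ _ f g

/-- `N` is symmetric. [cite: VanGeemenSarti2007, §1.5] -/
theorem isSymm_nikulinForm : nikulinForm.IsSymm :=
  nikulinNodeForm.isSymm_integralForm nondegenerate_nikulinNodeForm isSymm_nikulinNodeForm _ _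

/-- `N` is nondegenerate. [cite: VanGeemenSarti2007, §1.5] -/
theorem nondegenerate_nikulinForm : nikulinForm.Nondegenerate :=
  nikulinNodeForm.nondegenerate_integralForm nondegenerate_nikulinNodeForm isSymm_nikulinNodeForm _
    range_nikulinNodeForm_le _

/-- **`N` is an even lattice** (an even set of nodes). [cite: VanGeemenSarti2007, §1.5 ("an even set")] [cite: VanGeemenSarti2007, §1.10] -/
theorem isEven_nikulinForm : nikulinForm.IsEven :=
  (nikulinNodeForm.isEven_integralForm_iff _ _).2 nikulinLattice_even

/-- **`⊕ ℤ·Nᵢ ⊂ N` is a sublattice: `(i_Λ x . i_Λ y)_N = (x . y)`.** [cite: VanGeemenSarti2007, §1.5 ("contains the lattice `⟨-2⟩⁸`")] -/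
theorem nikulinForm_toOverlattice (x y : Fin 8 → ℤ) :
    nikulinForm (nikulinNodeForm.toOverlattice nikulinLattice range_nikulinNodeForm_le x)
      (nikulinNodeForm.toOverlattice nikulinLattice range_nikulinNodeForm_le y) = nikulinNodeForm x y :=
  nikulinNodeForm.integralForm_toOverlattice nondegenerate_nikulinNodeForm isSymm_nikulinNodeForm _ _ _ x y

/-- **`N̂² = -4`** (`= 8 · (-2)/4`). [cite: VanGeemenSarti2007, §1.5] -/
theorem nikulinForm_hat_hat :
    nikulinForm ⟨nikulinHat, nikulinHat_mem_nikulinLattice⟩ ⟨nikulinHat, nikulinHat_mem_nikulinLattice⟩ = -4 := by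
  have h : ((nikulinForm ⟨nikulinHat, nikulinHat_mem_nikulinLattice⟩ ⟨nikulinHat, nikulinHat_mem_nikulinLattice⟩ :
      ℤ) : ℚ) = -4 := by
    rw [nikulinForm_apply, Subtype.coe_mk, nikulinHat,
      nikulinBaseForm.dualForm_smul_apply_apply 2 nondegenerate_nikulinBaseForm two_ne_zero, nikulinBaseForm_apply,
      one_dotProduct]
    simp only [Pi.one_apply, Finset.sum_const, Finset.card_univ, Fintype.card_fin]
    push_cast
    norm_num
  exact_mod_cast h

/-- **"The lattice `N` has rank eight."** [cite: VanGeemenSarti2007, §1.5] -/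
theorem finrank_nikulinLattice : finrank ℤ nikulinLattice = 8 := by
  rw [nikulinNodeForm.finrank_overlattice_eq nondegenerate_nikulinNodeForm _ range_nikulinNodeForm_le,
    Module.finrank_fin_fun]

/-- **`N` is negative definite** (`(f . f) = -(Σ xᵢ²)/2 < 0` for `0 ≠ f = Σ xᵢ(Nᵢ/2)`). [cite: VanGeemenSarti2007, §1.5] [cite: Morrison1984, §5] -/
theorem negDef_nikulinForm : nikulinForm.NegDef := by
  rw [negDef_iff]
  intro f hf
  haveI : nikulinBaseForm.IsPerfPair := isUnimodular_nikulinBaseForm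
  obtain ⟨x, hx⟩ := (LinearMap.IsPerfPair.bijective_left nikulinBaseForm).2 (f : Module.Dual ℤ (Fin 8 → ℤ))
  have hx0 : x ≠ 0 := by
    rintro rfl
    apply hf
    rw [← Submodule.coe_eq_zero, ← hx, map_zero]
  have h0 : 0 ≤ x ⬝ᵥ x := Finset.sum_nonneg fun v _ ↦ mul_self_nonneg (x v)
  have h1 : x ⬝ᵥ x ≠ 0 := fun h ↦ hx0 (dotProduct_self_eq_zero.1 h)
  have h2 : (0 : ℚ) < x ⬝ᵥ x := by exact_mod_cast lt_of_le_of_ne h0 (Ne.symm h1)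
  have hq : ((nikulinForm f f : ℤ) : ℚ) = -(x ⬝ᵥ x : ℤ) / 2 := by
    rw [nikulinForm_apply, ← hx,
      nikulinBaseForm.dualForm_smul_apply_apply 2 nondegenerate_nikulinBaseForm two_ne_zero, nikulinBaseForm_apply]
    push_cast
    ring
  have h3 : ((nikulinForm f f : ℤ) : ℚ) < 0 := by rw [hq]; linarith
  exact_mod_cast h3

/-! ### §4 The dual lattice: "`n^* = Σ xᵢ(Nᵢ/2)` is in `N^*` iff `Σ xᵢ ≡ 0 mod 2`" -/

/-- `(Σ yᵢ(Nᵢ/2) . N̂)_{Λ_ℚ} = -(Σ yᵢ)/2`. [cite: VanGeemenSarti2007, §1.10 ("iff `n^*·(ΣNᵢ)/2 ∈ ℤ`")] -/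
theorem dualForm_nikulinBaseForm_nikulinHat (y : Fin 8 → ℤ) :
    nikulinNodeForm.dualForm (nikulinBaseForm y) nikulinHat = -((∑ i, y i : ℤ) : ℚ) / 2 := by
  rw [nikulinHat, nikulinBaseForm.dualForm_smul_apply_apply 2 nondegenerate_nikulinBaseForm two_ne_zero,
    nikulinBaseForm_apply, one_dotProduct]
  push_cast
  ring

/-- **van Geemen–Sarti: "`n^* ∈ ℤ(Nᵢ/2)` is in `N^*` iff `n^*·(ΣNᵢ)/2 ∈ ℤ`, that is, `n^* = Σ xᵢ(Nᵢ/2)` with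
`Σ xᵢ ≡ 0 mod 2`"** — membership of `nikulinBaseForm y ∈ Λ^*` in (the image in `Λ^*` of) `N^*`.
[cite: VanGeemenSarti2007, §1.10] -/
theorem mem_dual_nikulinLattice_iff (y : Fin 8 → ℤ) :
    nikulinBaseForm y ∈ LinearMap.range (nikulinNodeForm.toOverlattice nikulinLattice range_nikulinNodeForm_le).dualMap ↔
      (2 : ℤ) ∣ ∑ i, y i := by
  rw [nikulinNodeForm.mem_range_dualMap_toOverlattice_iff nondegenerate_nikulinNodeForm isSymm_nikulinNodeForm]
  constructor
  · intro h
    obtain ⟨n, hn⟩ := h nikulinHat nikulinHat_mem_nikulinLattice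
    rw [dualForm_nikulinBaseForm_nikulinHat] at hn
    refine ⟨-n, Int.cast_injective (α := ℚ) ?_⟩
    rw [Int.cast_mul, Int.cast_neg, Int.cast_ofNat]
    linarith
  · rintro ⟨k, hk⟩ g hg
    rw [nikulinLattice, Submodule.mem_sup] at hg
    obtain ⟨_, ⟨x, rfl⟩, g₂, hg₂, rfl⟩ := hg
    rw [Submodule.mem_span_singleton] at hg₂
    obtain ⟨m, rfl⟩ := hg₂
    refine ⟨nikulinBaseForm y x + m * (-k), ?_⟩
    rw [map_add, nikulinNodeForm.dualForm_apply_right nondegenerate_nikulinNodeForm isSymm_nikulinNodeForm,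
      dualForm_zsmul_right, dualForm_nikulinBaseForm_nikulinHat, hk]
    push_cast
    ring

/-- In particular `N̂ ∈ N^*`'s complement test: `Nᵢ/2 = nikulinBaseForm eᵢ ∉ N^*` (odd coordinate sum), while
`(Nᵢ + Nⱼ)/2 ∈ N^*`. [cite: VanGeemenSarti2007, §1.10 ("either `0`, `(Nᵢ + Nⱼ)/2` … or `(N₁ + Nᵢ + Nⱼ + N_k)/2`")] -/
theorem nikulinBaseForm_single_add_single_mem_dual (i j : Fin 8) :
    nikulinBaseForm (Pi.single i 1 + Pi.single j 1) ∈
      LinearMap.range (nikulinNodeForm.toOverlattice nikulinLattice range_nikulinNodeForm_le).dualMap := by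
  rw [mem_dual_nikulinLattice_iff]
  refine ⟨1, ?_⟩
  simp [Finset.sum_add_distrib]

/-! ### §5 `A_N ≅ (ℤ/2ℤ)⁶` and `ℓ(N) = 6` -/

/-- **`|A_N| = 2⁶`** (from (0.1): `|A_N| · [N : Λ]² = |A_Λ|`, i.e. `|A_N| · 2² = 2⁸`). [cite: VanGeemenSarti2007, §1.10 ("`A_N … ≅ (ℤ/2ℤ)⁶`")] [cite: Huybrechts2016K3, Ch. 14 §0.1 (0.1)] -/
theorem natCard_discriminantGroup_nikulinForm : Nat.card nikulinForm.discriminantGroup = 2 ^ 6 := by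
  have h := nikulinNodeForm.natCard_discriminantGroup_integralForm_mul_sq nondegenerate_nikulinNodeForm
    isSymm_nikulinNodeForm nikulinLattice range_nikulinNodeForm_le nikulinLattice_integral
  rw [natCard_map_mkQ_nikulinLattice, natCard_discriminantGroup_nikulinNodeForm,
    show (2 : ℕ) ^ 8 = 2 ^ 6 * 2 ^ 2 by norm_num] at h
  exact Nat.eq_of_mul_eq_mul_right (by positivity) h

/-- **`2 · A_N = 0`** (`A_N` is a subquotient of `A_Λ = ⊕ ℤ(Nᵢ/2)/⊕ ℤNᵢ`). [cite: VanGeemenSarti2007, §1.10 ("`A_N = N^*/N = {…}/⟨(1,…,1)⟩`")] -/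
theorem two_smul_discriminantGroup_nikulinForm (y : nikulinForm.discriminantGroup) : (2 : ℤ) • y = 0 := by
  obtain ⟨Ψ, -⟩ := nikulinNodeForm.exists_discriminantGroup_integralForm_equiv nondegenerate_nikulinNodeForm
    isSymm_nikulinNodeForm nikulinLattice range_nikulinNodeForm_le nikulinLattice_integral
  apply Ψ.injective
  obtain ⟨z, hz⟩ := Submodule.mkQ_surjective _ (Ψ y)
  have h2 : (2 : ℤ) • z = 0 :=
    Subtype.ext (two_smul_discriminantGroup_nikulinNodeForm (z : nikulinNodeForm.discriminantGroup))
  calc Ψ ((2 : ℤ) • y) = (2 : ℤ) • Ψ y := map_smul Ψ 2 y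
    _ = (2 : ℤ) • Submodule.mkQ _ z := by rw [hz]
    _ = Submodule.mkQ _ ((2 : ℤ) • z) := (map_smul _ 2 z).symm
    _ = 0 := by rw [h2, map_zero]
    _ = Ψ 0 := (map_zero Ψ).symm

/-- **van Geemen–Sarti: `A_N ≅ (ℤ/2ℤ)⁶`.** [cite: VanGeemenSarti2007, §1.10 ("`A_N = N^*/N = {(x₁,…,x₈) ∈ (ℤ/2ℤ)⁸ : Σ xᵢ = 0}/⟨(1,…,1)⟩ ≅ (ℤ/2ℤ)⁶`")] -/
theorem nonempty_discriminantGroup_nikulinForm_addEquiv :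
    Nonempty (nikulinForm.discriminantGroup ≃+ (Fin 6 → ZMod 2)) := by
  haveI := nikulinForm.finite_discriminantGroup nondegenerate_nikulinForm
  let _ : Module (ZMod 2) nikulinForm.discriminantGroup :=
    AddCommGroup.zmodModule fun y ↦ by rw [← natCast_zsmul]; exact two_smul_discriminantGroup_nikulinForm y
  exact nonempty_addEquiv_pi_zmod_of_card_eq natCard_discriminantGroup_nikulinForm

/-- `A_N ≃ A_{U(2)^{⊕3}}` as abelian groups (both `(ℤ/2ℤ)⁶`; van Geemen–Sarti prove the finer
`(A_K, q_K) ≅ (A_N, -q_N)`, `K = U(2)³`). [cite: VanGeemenSarti2007, §1.10 ("We will see that `(A_K,q_K) ≅ (A_N,-q_N)`")] -/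
theorem nonempty_discriminantGroup_nikulinForm_addEquiv_hyperbolicSum :
    Nonempty (nikulinForm.discriminantGroup ≃+ ((2 : ℤ) • hyperbolicSum 3).discriminantGroup) := by
  obtain ⟨e₁⟩ := nonempty_discriminantGroup_nikulinForm_addEquiv
  obtain ⟨e₂⟩ := nonempty_discriminantGroup_two_smul_hyperbolicSum_three_equiv
  exact ⟨e₁.trans ((LinearEquiv.funCongrLeft ℤ (ZMod 2) finSumFinEquiv).toAddEquiv.trans e₂.toAddEquiv.symm)⟩

/-- **`ℓ(N) = 6`.** [cite: VanGeemenSarti2007, §1.10 ("`A_N ≅ (ℤ/2ℤ)⁶`")] [cite: Huybrechts2016K3, Ch. 14 §0.1] -/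
theorem length_nikulinForm : nikulinForm.length = 6 := by
  obtain ⟨e⟩ := nonempty_discriminantGroup_nikulinForm_addEquiv_hyperbolicSum
  rw [length_eq_of_addEquiv e, length_two_smul_hyperbolicSum_three]

/-- `A_N ≃ A_K` as abelian groups, `K` the Kummer lattice (both `(ℤ/2ℤ)⁶`). [cite: VanGeemenSarti2007, §1.10] [cite: Huybrechts2016K3, Ch. 14 Prop. 3.14 (iv)] -/
theorem nonempty_discriminantGroup_nikulinForm_addEquiv_kummerForm :
    Nonempty (nikulinForm.discriminantGroup ≃+ kummerForm.discriminantGroup) := by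
  obtain ⟨e₁⟩ := nonempty_discriminantGroup_nikulinForm_addEquiv
  obtain ⟨e₂⟩ := nonempty_discriminantGroup_kummerForm_addEquiv
  exact ⟨e₁.trans e₂.symm⟩

/-! ### §6 The discriminant form `q_N`: `((Nᵢ+Nⱼ)/2)² ≡ 1`, `((N₁+Nᵢ+Nⱼ+N_k)/2)² ≡ 0 (mod 2ℤ)` -/

/-- `q_Λ([Σ yᵢ(Nᵢ/2)]) = (Σ yᵢNᵢ/2)² = −(y·y)/2 mod 2ℤ` on `A_Λ`, `Λ = ⊕ ℤNᵢ = ⟨−2⟩⁸`.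
[cite: VanGeemenSarti2007, §1.10 ("`Nᵢ² = −2`, hence `N^* ⊂ ℤ(Nᵢ/2)`")] -/
theorem discriminantQuad_mk_nikulinBaseForm (y : Fin 8 → ℤ) :
    nikulinNodeForm.discriminantQuad nondegenerate_nikulinNodeForm isSymm_nikulinNodeForm isEven_nikulinNodeForm
        (Submodule.Quotient.mk (nikulinBaseForm y)) =
      ((-((y ⬝ᵥ y : ℤ) : ℚ) / 2 : ℚ) : AddCircle (2 : ℚ)) := by
  have h := nikulinBaseForm.discriminantQuad_smul_twistIncl_mk 2 nondegenerate_nikulinBaseForm two_ne_zero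
    nondegenerate_nikulinNodeForm isSymm_nikulinNodeForm isEven_nikulinNodeForm y
  rw [twistIncl_mk, nikulinBaseForm_apply] at h
  rw [h]
  norm_cast

/-- An element `n^* = Σ yᵢ(Nᵢ/2) ∈ N^*` (`Σ yᵢ` even) as a functional on `N`: some `θ ∈ N^*` restricting to
`nikulinBaseForm y` on `Λ = ⊕ ℤNᵢ`. [cite: VanGeemenSarti2007, §1.10 ("`n^* = Σ xᵢ(Nᵢ/2)` with `Σ xᵢ ≡ 0 mod 2`")] -/
theorem exists_dualMap_eq_nikulinBaseForm {y : Fin 8 → ℤ} (hy : (2 : ℤ) ∣ ∑ i, y i) :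
    ∃ θ : Module.Dual ℤ nikulinLattice,
      (nikulinNodeForm.toOverlattice nikulinLattice range_nikulinNodeForm_le).dualMap θ = nikulinBaseForm y :=
  (mem_dual_nikulinLattice_iff y).2 hy

/-- **`q_N(Σ yᵢ(Nᵢ/2)) = −(Σ yᵢ²)/2 mod 2ℤ`** for `n^* = Σ yᵢ(Nᵢ/2) ∈ N^*` (`q_N([θ]) = q_Λ([θ|_Λ])`, Nikulin's
Prop. 1.4.1 (b), for the overlattice `N ⊃ Λ = ⟨−2⟩⁸`). [cite: VanGeemenSarti2007, §1.10] [cite: Nikulin1980, Prop. 1.4.1] -/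
theorem discriminantQuad_nikulinForm_mk (θ : Module.Dual ℤ nikulinLattice) {y : Fin 8 → ℤ}
    (hθ : (nikulinNodeForm.toOverlattice nikulinLattice range_nikulinNodeForm_le).dualMap θ = nikulinBaseForm y) :
    nikulinForm.discriminantQuad nondegenerate_nikulinForm isSymm_nikulinForm isEven_nikulinForm (Submodule.Quotient.mk θ) =
      ((-((y ⬝ᵥ y : ℤ) : ℚ) / 2 : ℚ) : AddCircle (2 : ℚ)) := by
  have h := nikulinNodeForm.discriminantQuad_integralForm_mk nondegenerate_nikulinNodeForm isSymm_nikulinNodeForm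
    isEven_nikulinNodeForm nikulinLattice range_nikulinNodeForm_le nikulinLattice_integral isEven_nikulinForm θ
  rw [hθ, discriminantQuad_mk_nikulinBaseForm] at h
  exact h

/-- `(eᵢ + eⱼ)·(eᵢ + eⱼ) = 2` for `i ≠ j`. [cite: VanGeemenSarti2007, §1.10] -/
theorem single_add_single_dotProduct_self {i j : Fin 8} (hij : i ≠ j) :
    (Pi.single i 1 + Pi.single j 1 : Fin 8 → ℤ) ⬝ᵥ (Pi.single i 1 + Pi.single j 1) = 2 := by
  simp [dotProduct_add, hij, hij.symm]

/-- **"`((Nᵢ + Nⱼ)/2)² = 1 mod 2ℤ`" (`i ≠ j`).** [cite: VanGeemenSarti2007, §1.10 (proof of Lemma 1.10)] -/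
theorem discriminantQuad_nikulinForm_pair {i j : Fin 8} (hij : i ≠ j) (θ : Module.Dual ℤ nikulinLattice)
    (hθ : (nikulinNodeForm.toOverlattice nikulinLattice range_nikulinNodeForm_le).dualMap θ =
      nikulinBaseForm (Pi.single i 1 + Pi.single j 1)) :
    nikulinForm.discriminantQuad nondegenerate_nikulinForm isSymm_nikulinForm isEven_nikulinForm (Submodule.Quotient.mk θ) =
      ((1 : ℚ) : AddCircle (2 : ℚ)) := by
  rw [discriminantQuad_nikulinForm_mk θ hθ, single_add_single_dotProduct_self hij, ← sub_eq_zero, ← AddCircle.coe_sub,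
    AddCircle.coe_eq_zero_iff]
  exact ⟨-1, by norm_num⟩

/-- The pair classes exist: `(Nᵢ + Nⱼ)/2 ∈ N^*`. [cite: VanGeemenSarti2007, §1.10] -/
theorem exists_dualMap_eq_pair (i j : Fin 8) : ∃ θ : Module.Dual ℤ nikulinLattice,
    (nikulinNodeForm.toOverlattice nikulinLattice range_nikulinNodeForm_le).dualMap θ =
      nikulinBaseForm (Pi.single i 1 + Pi.single j 1) :=
  nikulinBaseForm_single_add_single_mem_dual i j

/-- `(eᵢ + eⱼ + e_k + e_l)² = 4` for distinct indices. [cite: VanGeemenSarti2007, §1.10] -/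
theorem sum_four_single_dotProduct_self {i j k l : Fin 8} (hij : i ≠ j) (hik : i ≠ k) (hil : i ≠ l) (hjk : j ≠ k)
    (hjl : j ≠ l) (hkl : k ≠ l) :
    (Pi.single i 1 + Pi.single j 1 + Pi.single k 1 + Pi.single l 1 : Fin 8 → ℤ) ⬝ᵥ
        (Pi.single i 1 + Pi.single j 1 + Pi.single k 1 + Pi.single l 1) = 4 := by
  simp [dotProduct_add, hij, hij.symm, hik, hik.symm, hil, hil.symm, hjk, hjk.symm, hjl, hjl.symm,
    hkl, hkl.symm]

/-- The quadruple classes exist: `(Nᵢ + Nⱼ + N_k + N_l)/2 ∈ N^*`. [cite: VanGeemenSarti2007, §1.10] -/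
theorem exists_dualMap_eq_quadruple (i j k l : Fin 8) : ∃ θ : Module.Dual ℤ nikulinLattice,
    (nikulinNodeForm.toOverlattice nikulinLattice range_nikulinNodeForm_le).dualMap θ =
      nikulinBaseForm (Pi.single i 1 + Pi.single j 1 + Pi.single k 1 + Pi.single l 1) := by
  refine exists_dualMap_eq_nikulinBaseForm ⟨2, ?_⟩
  simp [Finset.sum_add_distrib]

/-- **"`((N₁ + Nᵢ + Nⱼ + N_k)/2)² = 0 mod 2`"** (distinct indices). [cite: VanGeemenSarti2007, §1.10 (proof of Lemma 1.10)] -/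
theorem discriminantQuad_nikulinForm_quadruple {i j k l : Fin 8} (hij : i ≠ j) (hik : i ≠ k) (hil : i ≠ l)
    (hjk : j ≠ k) (hjl : j ≠ l) (hkl : k ≠ l) (θ : Module.Dual ℤ nikulinLattice)
    (hθ : (nikulinNodeForm.toOverlattice nikulinLattice range_nikulinNodeForm_le).dualMap θ =
      nikulinBaseForm (Pi.single i 1 + Pi.single j 1 + Pi.single k 1 + Pi.single l 1)) :
    nikulinForm.discriminantQuad nondegenerate_nikulinForm isSymm_nikulinForm isEven_nikulinForm (Submodule.Quotient.mk θ) =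
      0 := by
  rw [discriminantQuad_nikulinForm_mk θ hθ, sum_four_single_dotProduct_self hij hik hil hjk hjl hkl,
    AddCircle.coe_eq_zero_iff]
  exact ⟨-1, by norm_num⟩

/-- **`q_N` is `ℤ/2ℤ`-valued**: for `n^* = Σ yᵢ(Nᵢ/2) ∈ N^*` with `yᵢ ∈ {0, 1}` (so `#{i | yᵢ = 1}` is even),
`q_N(n^*) = 0` if `4 ∣ #{i | yᵢ = 1}` and `q_N(n^*) = 1 mod 2ℤ` otherwise. [cite: VanGeemenSarti2007, §1.10 ("`((ℤ/2ℤ)⁶, q_N)` … quadratic spaces over the field `ℤ/2ℤ`")] -/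
theorem discriminantQuad_nikulinForm_mk_of_zero_one (θ : Module.Dual ℤ nikulinLattice) {y : Fin 8 → ℤ}
    (h01 : ∀ i, y i = 0 ∨ y i = 1)
    (hθ : (nikulinNodeForm.toOverlattice nikulinLattice range_nikulinNodeForm_le).dualMap θ = nikulinBaseForm y) :
    nikulinForm.discriminantQuad nondegenerate_nikulinForm isSymm_nikulinForm isEven_nikulinForm (Submodule.Quotient.mk θ) =
      if (4 : ℤ) ∣ ∑ i, y i then 0 else ((1 : ℚ) : AddCircle (2 : ℚ)) := by
  have hy2 : (2 : ℤ) ∣ ∑ i, y i := (mem_dual_nikulinLattice_iff y).1 ⟨θ, hθ⟩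
  have hyy : y ⬝ᵥ y = ∑ i, y i := Finset.sum_congr rfl fun i _ ↦ by
    rcases h01 i with h | h <;> simp [h]
  rw [discriminantQuad_nikulinForm_mk θ hθ, hyy]
  obtain ⟨m, hm⟩ := hy2
  split_ifs with h4
  · obtain ⟨k, hk⟩ := h4
    rw [AddCircle.coe_eq_zero_iff]
    exact ⟨-k, by rw [hk, zsmul_eq_mul]; push_cast; ring⟩
  · rw [← sub_eq_zero, ← AddCircle.coe_sub, AddCircle.coe_eq_zero_iff]
    have hm' : ¬(2 : ℤ) ∣ m := fun ⟨k, hk⟩ ↦ h4 ⟨k, by rw [hm, hk]; ring⟩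
    obtain ⟨k, hk⟩ : Odd m := Int.not_even_iff_odd.1 fun he ↦ hm' (even_iff_two_dvd.1 he)
    exact ⟨-(k + 1), by rw [hm, hk, zsmul_eq_mul]; push_cast; ring⟩

end Literature.AlgebraicGeometry.Surfaces
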